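import Summits.QuantumFields.BalabanUV.T4Continuum.Spine.NE3.FlatLandauGaugeBond
import HarnessLib

/-!
# T⁴ programme, node NE3 — [B8] AT THE FLAT BACKGROUND, brick E, letter 2b: ONE GAUGE STEP `U ↦ U^{e^λ}` AT `W = 1` —
# the flat divergence of the new potential is `covDiv 1 (log U) + Δ_1 λ` up to a junk term
# `≤ 4Λ(‖covDiv 1 log U‖ + ‖Δ_1 λ‖) + 25·d·r·γ + 14·d·γ²` (`FlatLandauGaugeStep`)

Cell `pub-balaban`, rung (B)+1 sub-cell t4, row NE3 (OWNER lineage `b2b-balaban-t4-ne3-p1`, generation 27; technique of record: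
implicit-function ∕ contraction mapping).  Second file of the chain «BRICK E OF REP♭ AT FLAT PAIRS» (the EXACT nonlinear
(1.38)-Landau step of [Balaban1985RegularSpaces] Sect. E, Prop. 5 pp. 89–94, AT THE FLAT BACKGROUND on the T⁴ programme's lattice;
asked of «row NE3's owner» by the CRUX prover NE7: HOME/INBOX [NE7P1-G72-INBOX-4], crux card
`t4/b2b-balaban-t4-ne7-p1-g72/REP-FLAT-CRUX-CARD.md` N3, road `t4/b2b-balaban-t4-ne7-p1-g73/REP-FLAT-ROAD-v2.md` §4 brick E),
over letter 1 `Spine/NE3/FlatLandauExpStar` (star second differences of the exponential).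

THE STEP.  Data on the `(N·L^k)`-torus read on `ℤᵈ`: a unitary bond field `V` with `‖V(b) − 1‖ ≤ r ≤ 1∕20` (so `Z := log V`
bondwise, `‖Z‖ ≤ 2r`), a skew site field `λ` with `‖λ‖ ≤ Λ ≤ 1∕10` and nearest-neighbour oscillation `‖λ(y+e_μ) − λ(y)‖ ≤ γ ≤ 1∕25`,
and the gauge transformation `u = e^{λ}` (unitary).  The new field `V′ := V^{u}`, `V′(x, μ) = u(x)·V(x, μ)·u(x+e_μ)⁻¹`
(`B7Prop1Explicit.gaugeAct`), has `‖V′(b) − 1‖ ≤ r + (5∕4)γ` and its potential `Z′ := log V′` satisfies, AT EVERY SITE `x`,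
  `‖covDiv 1 Z′ (x) − covDiv 1 Z (x) − Δ_1 λ (x)‖ ≤ 4Λ·(‖covDiv 1 Z (x)‖ + ‖Δ_1 λ (x)‖) + 25·d·r·γ + 14·d·γ²`
(`covDiv 1` = `NE3CovariantWeitzenbock.covDiv flatCfg` = the backward lattice divergence, `Δ_1` = `PairLandauB8.covLapSite flatCfg`
= `Σ_μ (2λ(x) − λ(x+e_μ) − λ(x−e_μ))`).  Every junk term is PROPORTIONAL to `λ` (it vanishes at `λ = 0`), and the linear response
`Δ_1 λ` is extracted EXACTLY — this is what makes the Newton scheme of letter 3 contract with a ratio `O(M·r + M²·b)` uniform in the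
block size `M = L^k` (with the (H0) letters `Λ ≤ c₀M²‖Δλ‖`, `γ ≤ c₁M‖Δλ‖`).

MECHANISM (bond `(x, μ)`): `V′ = Ṽ·g` with `Ṽ := u(x)V u(x)⁻¹` (unitary, `log Ṽ = Ad_{u(x)} log V`, tree `mlog_units_conj`) and the
PURE GAUGE `g := u(x)u(x+e_μ)⁻¹`; `log(Ṽg) = log Ṽ + log g + B`, `‖B‖ ≤ 2‖log Ṽ‖‖log g‖ ≤ 8rγ_u` by the tree's MIXED second-order BCH
bound [Balaban1985Averaging] (31) `B7Eq31BCH.eq31_printed`; the backward divergence of `log g` is `Σ_μ (log g₊ + log g₋)`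
(`log(w⁻¹) = −log w`), `= u(x)·Σ_μ (u(x+e_μ)⁻¹ + u(x−e_μ)⁻¹ − 2u(x)⁻¹) + O(γ_u²)` (second-order logarithm, tree `norm_mlog_sub_le`),
and with `u⁻¹ = e^{−λ}` the star lemma of letter 1 gives `Σ_μ (…) = Δ_1λ(x) + E`, `‖E‖ ≤ (e^Λ − 1)‖Δ_1λ(x)‖ + e^Λ·d·γ²`; the
conjugation defect `Ad_{u(x)} − Ad_{u(x−e_μ)}` costs `2γ_u` per bond and `Ad_{u(x)} − 1` costs `2(e^Λ − 1)` on `covDiv 1 Z(x)`.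

WHAT ([folklore]; `d` any, `n : Type*` nonempty finite; 0 def, 0 sorry; bond letters in letter 2a `Spine/NE3/FlatLandauGaugeBond`):
* `norm_sum_Ad_sub_covDiv_le` — the conjugation part; `norm_sum_mlog_pureGauge_sub_covLapSite_le` — the pure-gauge part (star lemma of letter 1);
* **`norm_covDiv_mlog_gaugeAct_sub_le`** — the displayed junk bound; `gaugeAct_letters` — new radius `r + (5∕4)γ`, `‖log V^{u}(b)‖ ≤ 2(r + (5∕4)γ)`,
  skewness and unitarity of the new bond variables.

HONEST FRAMING (page 1): elementary lattice ∕ Banach-algebra analysis of OUR objects at the FLAT background; nothing of Bałaban's is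
used, asserted or discharged; brick E is NOT landed by this file (letter 3 iterates it); REP♭ NOT proved; NE3 ∕ NE7 NOT proved;
spine PROVED 0∕9; finite T⁴ rung (B)+1 — NOT infinite volume, NOT mass gap, NOT `BetaPertH`, NOT Clay.  Continuum YM on T⁴ ⇐
BetaPertH ∧ nine spine estimates (0/9 proved); BetaPertH ⇐ (D1) ∧ (D4) ∧ CAP+tail; G-an2-4 gates asym, D1 and NE2/3/4.  PLACEMENT: our
lemma, `Spine/NE3/`; imports letter 2a `Spine/NE3/FlatLandauGaugeBond` (hence row NE3's flat Landau letters, letter 1 and `B7Eq31BCH`).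
-/

set_option autoImplicit false

open NormedSpace
open scoped BigOperators Matrix.Norms.L2Operator
open Finset

namespace Summit.QuantumFields.BalabanUV.T4Continuum.NE3.FlatLandauGaugeStep

open Literature.MathematicalPhysics.QuantumFieldTheory.Balaban1983to89
open B7Prop1Explicit B7Prop2Explicit MatrixLog
open T4AveragingDeficitWall (Ad IsUnitaryCfg IsSkewDir)
open T4AveragingDeficitWallBoundary (IsPeriodicCfg periodBox)
open AveragingDeficitPeriodicCounting (IsPeriodicDir)
open AveragingDeficitNearIdentity (norm_Ad_sub_le)
open AveragingDeficitTransport (norm_Ad_of_unitary mem_U1_of_unitary)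
open MinimalActionWitness (flatCfg)
open NE3EnergyShapes (IsUnitarySite IsPeriodicSite)
open NE3CovariantWeitzenbock (covDiv covDiv_flatCfg)
open NE3.PairLandauB8 (covLapSite)
open NE3.LandauCorrectionSupB8FlatH0 (covLapSite_flatCfg_eq_neg_laplacian)
open NE7ExpLogSecondOrder (norm_expTail_sub_expTail_le real_exp_sub_one_le_two_mul)
open NE3.FlatLandauExpStar (norm_starSum_exp_le)

noncomputable section

variable {d : ℕ} {n : Type*} [Fintype n] [DecidableEq n]

open NE3.FlatLandauGaugeBond

/-! ## §3 The backward divergence of the new potential: `covDiv 1 (log V^u) = covDiv 1 (log V) + Δ_1 λ + junk` -/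

section Divergence

variable [Nonempty n]

/-- **THE CONJUGATION PART**: for unitary sites `u` with `‖u(y) − 1‖ ≤ σ` and `‖u(x) − u(x − e_μ)‖ ≤ γ_u`, and a bond field `Z` with
`‖Z‖ ≤ z`: `‖Σ_μ (Ad_{u(x)} Z(x,μ) − Ad_{u(x−e_μ)} Z(x−e_μ,μ)) − covDiv 1 Z (x)‖ ≤ 2σ·‖covDiv 1 Z (x)‖ + 2·d·γ_u·z`
(`= (Ad_{u(x)} − 1)(covDiv 1 Z(x)) + Σ_μ (Ad_{u(x)} − Ad_{u(x−e_μ)}) Z(x−e_μ, μ)`). [folklore] -/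
theorem norm_sum_Ad_sub_covDiv_le {u : Site d → (Matrix n n ℂ)ˣ} (huU : IsUnitarySite u) {σ γu z : ℝ} (hσ : ∀ y, ‖(u y : (Matrix n n ℂ)) - 1‖ ≤ σ)
    (hγu : ∀ (y : Site d) (μ : Fin d), ‖(u y : (Matrix n n ℂ)) - u (y - e μ)‖ ≤ γu) {Z : Site d → Fin d → (Matrix n n ℂ)} (hz : ∀ y μ, ‖Z y μ‖ ≤ z) (x : Site d) :
    ‖∑ μ : Fin d, (Ad (u x) (Z x μ) - Ad (u (x - e μ)) (Z (x - e μ) μ)) - covDiv flatCfg Z x‖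
      ≤ 2 * σ * ‖covDiv flatCfg Z x‖ + 2 * d * γu * z := by
  have hAdsub : ∀ (v : (Matrix n n ℂ)ˣ) (X Y : (Matrix n n ℂ)), Ad v (X - Y) = Ad v X - Ad v Y := fun v X Y => by unfold Ad; noncomm_ring
  have hcd : Ad (u x) (covDiv flatCfg Z x) = ∑ μ : Fin d, (Ad (u x) (Z x μ) - Ad (u x) (Z (x - e μ) μ)) := by
    rw [covDiv_flatCfg, AveragingDeficitNearIdentity.Ad_sum]
    exact Finset.sum_congr rfl fun μ _ => hAdsub _ _ _
  have hid : ∑ μ : Fin d, (Ad (u x) (Z x μ) - Ad (u (x - e μ)) (Z (x - e μ) μ)) - covDiv flatCfg Z x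
      = (Ad (u x) (covDiv flatCfg Z x) - covDiv flatCfg Z x)
        + ∑ μ : Fin d, (Ad (u x) (Z (x - e μ) μ) - Ad (u (x - e μ)) (Z (x - e μ) μ)) := by
    have h1 : ∑ μ : Fin d, (Ad (u x) (Z x μ) - Ad (u (x - e μ)) (Z (x - e μ) μ))
        = ∑ μ : Fin d, (Ad (u x) (Z x μ) - Ad (u x) (Z (x - e μ) μ))
          + ∑ μ : Fin d, (Ad (u x) (Z (x - e μ) μ) - Ad (u (x - e μ)) (Z (x - e μ) μ)) := by
      rw [← Finset.sum_add_distrib]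
      exact Finset.sum_congr rfl fun μ _ => by abel
    rw [h1, hcd]
    abel
  rw [hid]
  have h1 : ‖Ad (u x) (covDiv flatCfg Z x) - covDiv flatCfg Z x‖ ≤ 2 * σ * ‖covDiv flatCfg Z x‖ :=
    (norm_Ad_sub_le (huU x) _).trans (by gcongr; exact hσ x)
  have h2 : ‖∑ μ : Fin d, (Ad (u x) (Z (x - e μ) μ) - Ad (u (x - e μ)) (Z (x - e μ) μ))‖ ≤ 2 * d * γu * z := by
    calc _ ≤ ∑ μ : Fin d, 2 * ‖(u x : (Matrix n n ℂ)) - u (x - e μ)‖ * ‖Z (x - e μ) μ‖ :=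
          (norm_sum_le _ _).trans (Finset.sum_le_sum fun μ _ => norm_Ad_sub_Ad_le (huU x) (huU (x - e μ)) _)
      _ ≤ ∑ _μ : Fin d, 2 * γu * z := Finset.sum_le_sum fun μ _ =>
          mul_le_mul (mul_le_mul_of_nonneg_left (hγu x μ) two_pos.le) (hz _ _) (norm_nonneg _)
            (by linarith [norm_nonneg ((u x : (Matrix n n ℂ)) - u (x - e μ)), hγu x μ])
      _ = 2 * d * γu * z := by simp; ring
  exact (norm_add_le _ _).trans ((add_le_add h1 h2).trans (le_of_eq rfl))

/-- **THE PURE-GAUGE PART** — the backward divergence of `log(u(x)u(x+e_μ)⁻¹)` is `Δ_1 λ(x)` to second order: for a site field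
`λ` with `‖λ‖ ≤ Λ ≤ 1∕10`, nearest-neighbour oscillation `≤ γ ≤ 1∕25` and a unitary `u = e^{λ}`,
`‖Σ_μ (log(u(x)u(x+e_μ)⁻¹) + log(u(x)u(x−e_μ)⁻¹)) − Δ_1 λ(x)‖ ≤ 4Λ·‖Δ_1 λ(x)‖ + 14·d·γ²`
(second-order logarithm per bond, tree `norm_mlog_sub_le`; the star lemma `FlatLandauExpStar.norm_starSum_exp_le` on `u⁻¹ = e^{−λ}` over
the `2d` neighbours of `x` (index `Fin d ⊕ Fin d`) extracts `Δ_1λ(x)` EXACTLY; `e^Λ − 1 ≤ 2Λ`, `e^Λ ≤ 5∕4`). [folklore] -/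
theorem norm_sum_mlog_pureGauge_sub_covLapSite_le {lam : Site d → (Matrix n n ℂ)} {Λ γ : ℝ}
    (hΛ : ∀ y, ‖lam y‖ ≤ Λ) (hΛ1 : Λ ≤ 1 / 10) (hγ : ∀ (y : Site d) (μ : Fin d), ‖lam (y + e μ) - lam y‖ ≤ γ) (hγ1 : γ ≤ 1 / 25)
    {u : Site d → (Matrix n n ℂ)ˣ} (huU : IsUnitarySite u) (hu : ∀ y, (u y : (Matrix n n ℂ)) = exp (lam y)) (x : Site d) :
    ‖∑ μ : Fin d, (mlog ((u x * (u (x + e μ))⁻¹ : (Matrix n n ℂ)ˣ) : (Matrix n n ℂ)) + mlog ((u x * (u (x - e μ))⁻¹ : (Matrix n n ℂ)ˣ) : (Matrix n n ℂ)))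
        - covLapSite flatCfg lam x‖ ≤ 4 * Λ * ‖covLapSite flatCfg lam x‖ + 14 * d * γ ^ 2 := by
  rcases Nat.eq_zero_or_pos d with hd | hd
  · subst hd
    simp [covLapSite_flatCfg_eq_neg_laplacian]
  have hΛ0 : 0 ≤ Λ := (norm_nonneg _).trans (hΛ x)
  have hγ0 : 0 ≤ γ := (norm_nonneg _).trans (hγ x ⟨0, hd⟩)
  have hγ' : ∀ (y : Site d) (μ : Fin d), ‖lam y - lam (y - e μ)‖ ≤ γ := fun y μ => by
    have h := hγ (y - e μ) μ; rwa [sub_add_cancel] at h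
  have hE : Real.exp Λ ≤ 5 / 4 := (Real.exp_le_exp.mpr hΛ1).trans exp_tenth_le
  have hE1 : Real.exp Λ - 1 ≤ 2 * Λ := real_exp_sub_one_le_two_mul hΛ0 (by linarith)
  have hσ : ‖(u x : (Matrix n n ℂ)) - 1‖ ≤ 2 * Λ := norm_expGauge_sub_one_le hu hΛ (by linarith) x
  have hux1 : ‖(u x : (Matrix n n ℂ))‖ = 1 := CStarRing.norm_of_mem_unitary (mem_unitaryUnits.mp (huU x))
  -- the `2d` pure gauges and their distance to `1`
  have hgp : ∀ μ : Fin d, ‖((u x * (u (x + e μ))⁻¹ : (Matrix n n ℂ)ˣ) : (Matrix n n ℂ)) - 1‖ ≤ 5 / 4 * γ := fun μ =>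
    (norm_pureGauge_sub_one_le (huU _)).trans ((norm_expGauge_sub_expGauge_le hu hΛ hΛ1 _ _).trans
      (by rw [norm_sub_rev]; linarith [hγ x μ]))
  have hgm : ∀ μ : Fin d, ‖((u x * (u (x - e μ))⁻¹ : (Matrix n n ℂ)ˣ) : (Matrix n n ℂ)) - 1‖ ≤ 5 / 4 * γ := fun μ =>
    (norm_pureGauge_sub_one_le (huU _)).trans ((norm_expGauge_sub_expGauge_le hu hΛ hΛ1 _ _).trans
      (by linarith [hγ' x μ]))
  -- second-order logarithm on each pure gauge
  have hq : ∀ {g : (Matrix n n ℂ)ˣ}, ‖(g : (Matrix n n ℂ)) - 1‖ ≤ 5 / 4 * γ → ‖mlog (g : (Matrix n n ℂ)) - ((g : (Matrix n n ℂ)) - 1)‖ ≤ (5 / 2 * γ) ^ 2 := by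
    intro g hg
    have h1 := norm_mlog_sub_le (W := (g : (Matrix n n ℂ))) (by linarith)
    exact h1.trans ((expRem_mono (by positivity) (by linarith : 2 * ‖(g : (Matrix n n ℂ)) - 1‖ ≤ 5 / 2 * γ)).trans
      (expRem_le_sq (by positivity) (by linarith)))
  -- the inverses are `e^{−λ}`
  have hinv : ∀ y, (((u y)⁻¹ : (Matrix n n ℂ)ˣ) : (Matrix n n ℂ)) = exp (-lam y) := fun y => units_val_inv_eq_exp_neg (hu y)
  have hone : (u x : (Matrix n n ℂ)) * exp (-lam x) = 1 := by rw [← hinv x, Units.mul_inv]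
  -- THE STAR LEMMA over the `2d` neighbours of `x`, index `Fin d ⊕ Fin d`
  have hstar := norm_starSum_exp_le (Finset.univ : Finset (Fin d ⊕ Fin d)) (X := -lam x)
    (Y := Sum.elim (fun μ : Fin d => lam x - lam (x + e μ)) (fun μ : Fin d => lam x - lam (x - e μ)))
    (ρ := Λ) (δ := ‖covLapSite flatCfg lam x‖) (σ := 2 * d * γ ^ 2)
    (by rw [norm_neg]; exact hΛ x)
    (by
      rintro (μ | μ) -
      · rw [Sum.elim_inl, show -lam x + (lam x - lam (x + e μ)) = -lam (x + e μ) by abel, norm_neg]; exact hΛ _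
      · rw [Sum.elim_inr, show -lam x + (lam x - lam (x - e μ)) = -lam (x - e μ) by abel, norm_neg]; exact hΛ _)
    (by
      rw [Fintype.sum_sum_type, covLapSite_flatCfg_eq_neg_laplacian]
      simp only [Sum.elim_inl, Sum.elim_inr]
      rw [← Finset.sum_add_distrib, ← Finset.sum_neg_distrib]
      exact le_of_eq (congrArg _ (Finset.sum_congr rfl fun μ _ => by abel)))
    (by
      rw [Fintype.sum_sum_type]
      simp only [Sum.elim_inl, Sum.elim_inr]
      calc ∑ μ : Fin d, ‖lam x - lam (x + e μ)‖ ^ 2 + ∑ μ : Fin d, ‖lam x - lam (x - e μ)‖ ^ 2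
          ≤ ∑ _μ : Fin d, γ ^ 2 + ∑ _μ : Fin d, γ ^ 2 :=
            add_le_add (Finset.sum_le_sum fun μ _ => pow_le_pow_left₀ (norm_nonneg _) (by rw [norm_sub_rev]; exact hγ x μ) 2)
              (Finset.sum_le_sum fun μ _ => pow_le_pow_left₀ (norm_nonneg _) (hγ' x μ) 2)
        _ = 2 * d * γ ^ 2 := by simp; ring)
  -- the star sum is `S := Σ_μ ((u(x+e_μ)⁻¹ − u(x)⁻¹) + (u(x−e_μ)⁻¹ − u(x)⁻¹))`, its linear part is `Δ_1λ(x)`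
  set Lap := covLapSite flatCfg lam x with hLap
  set S := ∑ μ : Fin d, ((exp (-lam (x + e μ)) - exp (-lam x)) + (exp (-lam (x - e μ)) - exp (-lam x))) with hS_def
  have hstar' : ‖S - Lap‖ ≤ (Real.exp Λ - 1) * ‖Lap‖ + Real.exp Λ * (2 * d * γ ^ 2 / 2) := by
    have hS : ∑ i ∈ (Finset.univ : Finset (Fin d ⊕ Fin d)),
        (exp (-lam x + Sum.elim (fun μ : Fin d => lam x - lam (x + e μ)) (fun μ : Fin d => lam x - lam (x - e μ)) i) - exp (-lam x)) = S := by
      rw [Fintype.sum_sum_type, hS_def, ← Finset.sum_add_distrib]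
      refine Finset.sum_congr rfl fun μ _ => ?_
      rw [Sum.elim_inl, Sum.elim_inr, show -lam x + (lam x - lam (x + e μ)) = -lam (x + e μ) by abel,
        show -lam x + (lam x - lam (x - e μ)) = -lam (x - e μ) by abel]
    have hL : ∑ i ∈ (Finset.univ : Finset (Fin d ⊕ Fin d)),
        Sum.elim (fun μ : Fin d => lam x - lam (x + e μ)) (fun μ : Fin d => lam x - lam (x - e μ)) i = Lap := by
      rw [Fintype.sum_sum_type, hLap, covLapSite_flatCfg_eq_neg_laplacian]
      simp only [Sum.elim_inl, Sum.elim_inr]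
      rw [← Finset.sum_add_distrib, ← Finset.sum_neg_distrib]
      exact Finset.sum_congr rfl fun μ _ => by abel
    rw [hS, hL] at hstar
    exact hstar
  -- per direction: `(g₊ − 1) + (g₋ − 1) = u(x)·((u(x+e_μ)⁻¹ − u(x)⁻¹) + (u(x−e_μ)⁻¹ − u(x)⁻¹))`
  have hdir : ∀ μ : Fin d, (((u x * (u (x + e μ))⁻¹ : (Matrix n n ℂ)ˣ) : (Matrix n n ℂ)) - 1) + ((((u x * (u (x - e μ))⁻¹ : (Matrix n n ℂ)ˣ) : (Matrix n n ℂ)) - 1))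
      = (u x : (Matrix n n ℂ)) * ((exp (-lam (x + e μ)) - exp (-lam x)) + (exp (-lam (x - e μ)) - exp (-lam x))) := by
    intro μ
    rw [Units.val_mul, Units.val_mul, hinv, hinv, mul_add, mul_sub, mul_sub, hone]
  have h2 : ∑ μ : Fin d, ((((u x * (u (x + e μ))⁻¹ : (Matrix n n ℂ)ˣ) : (Matrix n n ℂ)) - 1) + ((((u x * (u (x - e μ))⁻¹ : (Matrix n n ℂ)ˣ) : (Matrix n n ℂ)) - 1)))
      = (u x : (Matrix n n ℂ)) * S := by
    rw [hS_def, Finset.mul_sum]; exact Finset.sum_congr rfl fun μ _ => hdir μ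
  -- the decomposition of the target: `Q + ((u x − 1)·Lap + u x·(S − Lap))`
  have hid : ∑ μ : Fin d, (mlog ((u x * (u (x + e μ))⁻¹ : (Matrix n n ℂ)ˣ) : (Matrix n n ℂ)) + mlog ((u x * (u (x - e μ))⁻¹ : (Matrix n n ℂ)ˣ) : (Matrix n n ℂ))) - Lap
      = ∑ μ : Fin d, ((mlog ((u x * (u (x + e μ))⁻¹ : (Matrix n n ℂ)ˣ) : (Matrix n n ℂ)) - ((((u x * (u (x + e μ))⁻¹ : (Matrix n n ℂ)ˣ) : (Matrix n n ℂ))) - 1))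
          + (mlog ((u x * (u (x - e μ))⁻¹ : (Matrix n n ℂ)ˣ) : (Matrix n n ℂ)) - ((((u x * (u (x - e μ))⁻¹ : (Matrix n n ℂ)ˣ) : (Matrix n n ℂ))) - 1)))
        + (((u x : (Matrix n n ℂ)) - 1) * Lap + (u x : (Matrix n n ℂ)) * (S - Lap)) := by
    have h3 : ((u x : (Matrix n n ℂ)) - 1) * Lap + (u x : (Matrix n n ℂ)) * (S - Lap) = (u x : (Matrix n n ℂ)) * S - Lap := by noncomm_ring
    have h4 : ∑ μ : Fin d, (mlog ((u x * (u (x + e μ))⁻¹ : (Matrix n n ℂ)ˣ) : (Matrix n n ℂ)) + mlog ((u x * (u (x - e μ))⁻¹ : (Matrix n n ℂ)ˣ) : (Matrix n n ℂ)))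
        = ∑ μ : Fin d, ((mlog ((u x * (u (x + e μ))⁻¹ : (Matrix n n ℂ)ˣ) : (Matrix n n ℂ)) - ((((u x * (u (x + e μ))⁻¹ : (Matrix n n ℂ)ˣ) : (Matrix n n ℂ))) - 1))
            + (mlog ((u x * (u (x - e μ))⁻¹ : (Matrix n n ℂ)ˣ) : (Matrix n n ℂ)) - ((((u x * (u (x - e μ))⁻¹ : (Matrix n n ℂ)ˣ) : (Matrix n n ℂ))) - 1)))
          + ∑ μ : Fin d, ((((u x * (u (x + e μ))⁻¹ : (Matrix n n ℂ)ˣ) : (Matrix n n ℂ)) - 1) + ((((u x * (u (x - e μ))⁻¹ : (Matrix n n ℂ)ˣ) : (Matrix n n ℂ)) - 1))) := by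
      rw [← Finset.sum_add_distrib]
      exact Finset.sum_congr rfl fun μ _ => by abel
    rw [h3, h4, h2]
    abel
  rw [hid]
  have hQ : ‖∑ μ : Fin d, ((mlog ((u x * (u (x + e μ))⁻¹ : (Matrix n n ℂ)ˣ) : (Matrix n n ℂ)) - ((((u x * (u (x + e μ))⁻¹ : (Matrix n n ℂ)ˣ) : (Matrix n n ℂ))) - 1))
          + (mlog ((u x * (u (x - e μ))⁻¹ : (Matrix n n ℂ)ˣ) : (Matrix n n ℂ)) - ((((u x * (u (x - e μ))⁻¹ : (Matrix n n ℂ)ˣ) : (Matrix n n ℂ))) - 1)))‖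
      ≤ d * (2 * (5 / 2 * γ) ^ 2) := by
    calc _ ≤ ∑ _μ : Fin d, ((5 / 2 * γ) ^ 2 + (5 / 2 * γ) ^ 2) :=
          (norm_sum_le _ _).trans (Finset.sum_le_sum fun μ _ => (norm_add_le _ _).trans (add_le_add (hq (hgp μ)) (hq (hgm μ))))
      _ = d * (2 * (5 / 2 * γ) ^ 2) := by simp; ring
  have hR : ‖((u x : (Matrix n n ℂ)) - 1) * Lap + (u x : (Matrix n n ℂ)) * (S - Lap)‖ ≤ 2 * Λ * ‖Lap‖ + ((2 * Λ) * ‖Lap‖ + 5 / 4 * (2 * d * γ ^ 2 / 2)) := by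
    calc _ ≤ ‖(u x : (Matrix n n ℂ)) - 1‖ * ‖Lap‖ + ‖(u x : (Matrix n n ℂ))‖ * ‖S - Lap‖ :=
          (norm_add_le _ _).trans (add_le_add (norm_mul_le _ _) (norm_mul_le _ _))
      _ ≤ 2 * Λ * ‖Lap‖ + 1 * ((Real.exp Λ - 1) * ‖Lap‖ + Real.exp Λ * (2 * d * γ ^ 2 / 2)) := by
          rw [hux1]; gcongr
      _ ≤ 2 * Λ * ‖Lap‖ + 1 * ((2 * Λ) * ‖Lap‖ + 5 / 4 * (2 * d * γ ^ 2 / 2)) := by gcongr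
      _ = _ := by ring
  have hd0 : (0 : ℝ) ≤ d := Nat.cast_nonneg d
  calc _ ≤ d * (2 * (5 / 2 * γ) ^ 2) + (2 * Λ * ‖Lap‖ + ((2 * Λ) * ‖Lap‖ + 5 / 4 * (2 * d * γ ^ 2 / 2))) :=
        (norm_add_le _ _).trans (add_le_add hQ hR)
    _ ≤ 4 * Λ * ‖Lap‖ + 14 * d * γ ^ 2 := by nlinarith [mul_nonneg hd0 (sq_nonneg γ)]

/-- **ONE GAUGE STEP AT THE FLAT BACKGROUND — THE DIVERGENCE OF THE NEW POTENTIAL.**  For a unitary bond field `V` with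
`‖V(b) − 1‖ ≤ r ≤ 1∕20`, a skew site field `λ` with `‖λ‖ ≤ Λ ≤ 1∕10` and nearest-neighbour oscillation `≤ γ ≤ 1∕25`, and the unitary
gauge transformation `u = e^{λ}`: with `Z := log V`, `Z′ := log V^{u}` (bondwise, `V^{u}(x,μ) = u(x)V(x,μ)u(x+e_μ)⁻¹`),
`‖covDiv 1 Z′(x) − covDiv 1 Z(x) − Δ_1λ(x)‖ ≤ 4Λ·(‖covDiv 1 Z(x)‖ + ‖Δ_1λ(x)‖) + 25·d·r·γ + 14·d·γ²` at every site `x`.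
[Balaban1985RegularSpaces] Sect. E (1.94)–(1.100) TYPE (the linearisation of the Landau map at `U₀ = 1`), here an elementary
lattice identity-with-remainder; every junk term vanishes at `λ = 0`. [folklore] -/
theorem norm_covDiv_mlog_gaugeAct_sub_le {V : Site d → Fin d → (Matrix n n ℂ)ˣ} (hV : IsUnitaryCfg V) {r : ℝ}
    (hr : ∀ (y : Site d) (μ : Fin d), ‖(V y μ : (Matrix n n ℂ)) - 1‖ ≤ r) (hr1 : r ≤ 1 / 20)
    {lam : Site d → (Matrix n n ℂ)} (hlams : ∀ y, lam y ∈ skewAdjoint (Matrix n n ℂ)) {Λ γ : ℝ}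
    (hΛ : ∀ y, ‖lam y‖ ≤ Λ) (hΛ1 : Λ ≤ 1 / 10) (hγ : ∀ (y : Site d) (μ : Fin d), ‖lam (y + e μ) - lam y‖ ≤ γ) (hγ1 : γ ≤ 1 / 25)
    {u : Site d → (Matrix n n ℂ)ˣ} (hu : ∀ y, (u y : (Matrix n n ℂ)) = exp (lam y)) (x : Site d) :
    ‖covDiv flatCfg (fun y μ => mlog ((gaugeAct u V y μ : (Matrix n n ℂ)ˣ) : (Matrix n n ℂ))) x - covDiv flatCfg (fun y μ => mlog (V y μ : (Matrix n n ℂ))) x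
        - covLapSite flatCfg lam x‖
      ≤ 4 * Λ * (‖covDiv flatCfg (fun y μ => mlog (V y μ : (Matrix n n ℂ))) x‖ + ‖covLapSite flatCfg lam x‖) + 25 * d * r * γ + 14 * d * γ ^ 2 := by
  rcases Nat.eq_zero_or_pos d with hd | hd
  · subst hd
    simp [covDiv_flatCfg, covLapSite_flatCfg_eq_neg_laplacian]
  have hΛ0 : 0 ≤ Λ := (norm_nonneg _).trans (hΛ x)
  have hγ0 : 0 ≤ γ := (norm_nonneg _).trans (hγ x ⟨0, hd⟩)
  have hr0 : 0 ≤ r := (norm_nonneg _).trans (hr x ⟨0, hd⟩)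
  have huU : IsUnitarySite u := expGauge_unitary hlams hu
  have hγ' : ∀ (y : Site d) (μ : Fin d), ‖lam y - lam (y - e μ)‖ ≤ γ := fun y μ => by
    have h := hγ (y - e μ) μ; rwa [sub_add_cancel] at h
  have hσ : ∀ y, ‖(u y : (Matrix n n ℂ)) - 1‖ ≤ 2 * Λ := norm_expGauge_sub_one_le hu hΛ (by linarith)
  have hγup : ∀ (y : Site d) (μ : Fin d), ‖(u y : (Matrix n n ℂ)) - u (y + e μ)‖ ≤ 5 / 4 * γ := fun y μ =>
    (norm_expGauge_sub_expGauge_le hu hΛ hΛ1 _ _).trans (by rw [norm_sub_rev]; linarith [hγ y μ])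
  have hγdn : ∀ (y : Site d) (μ : Fin d), ‖(u y : (Matrix n n ℂ)) - u (y - e μ)‖ ≤ 5 / 4 * γ := fun y μ =>
    (norm_expGauge_sub_expGauge_le hu hΛ hΛ1 _ _).trans (by linarith [hγ' y μ])
  set Z : Site d → Fin d → (Matrix n n ℂ) := fun y μ => mlog (V y μ : (Matrix n n ℂ)) with hZ_def
  have hZn : ∀ (y : Site d) (μ : Fin d), ‖Z y μ‖ ≤ 2 * r := fun y μ =>
    (norm_mlog_le_two_mul ((hr y μ).trans (by linarith))).trans (by linarith [hr y μ])
  -- the bond junk `B := log V^u − Ad_u log V − log(u u′⁻¹)`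
  set B : Site d → Fin d → (Matrix n n ℂ) := fun y μ =>
    mlog ((gaugeAct u V y μ : (Matrix n n ℂ)ˣ) : (Matrix n n ℂ)) - Ad (u y) (Z y μ) - mlog ((u y * (u (y + e μ))⁻¹ : (Matrix n n ℂ)ˣ) : (Matrix n n ℂ)) with hB_def
  have hB : ∀ (y : Site d) (μ : Fin d), ‖B y μ‖ ≤ 8 * r * (5 / 4 * γ) := fun y μ =>
    norm_mlog_gaugeBond_sub_le (huU y) (huU (y + e μ)) (hr y μ) hr1 (hγup y μ) (by linarith)
  have hpt : ∀ (y : Site d) (μ : Fin d), mlog ((gaugeAct u V y μ : (Matrix n n ℂ)ˣ) : (Matrix n n ℂ))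
      = Ad (u y) (Z y μ) + mlog ((u y * (u (y + e μ))⁻¹ : (Matrix n n ℂ)ˣ) : (Matrix n n ℂ)) + B y μ := fun y μ => by
    simp only [hB_def]; abel
  -- the backward pure gauge: `log(u(x−e_μ)u(x)⁻¹) = −log(u(x)u(x−e_μ)⁻¹)`
  have hGback : ∀ μ : Fin d, mlog ((u (x - e μ) * (u (x - e μ + e μ))⁻¹ : (Matrix n n ℂ)ˣ) : (Matrix n n ℂ))
      = -mlog ((u x * (u (x - e μ))⁻¹ : (Matrix n n ℂ)ˣ) : (Matrix n n ℂ)) := by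
    intro μ
    have hw : ((u x * (u (x - e μ))⁻¹)⁻¹ : (Matrix n n ℂ)ˣ) = u (x - e μ) * (u (x - e μ + e μ))⁻¹ := by
      rw [mul_inv_rev, inv_inv, sub_add_cancel]
    have h1 : ‖((u x * (u (x - e μ))⁻¹ : (Matrix n n ℂ)ˣ) : (Matrix n n ℂ)) - 1‖ ≤ 1 / 4 :=
      ((norm_pureGauge_sub_one_le (huU _)).trans (hγdn x μ)).trans (by linarith)
    rw [← hw, mlog_inv_unit h1]
  -- the three-term splitting of the new divergence
  have hZ' : covDiv flatCfg (fun y μ => mlog ((gaugeAct u V y μ : (Matrix n n ℂ)ˣ) : (Matrix n n ℂ))) x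
      = ∑ μ : Fin d, (Ad (u x) (Z x μ) - Ad (u (x - e μ)) (Z (x - e μ) μ))
        + ∑ μ : Fin d, (mlog ((u x * (u (x + e μ))⁻¹ : (Matrix n n ℂ)ˣ) : (Matrix n n ℂ)) + mlog ((u x * (u (x - e μ))⁻¹ : (Matrix n n ℂ)ˣ) : (Matrix n n ℂ)))
        + ∑ μ : Fin d, (B x μ - B (x - e μ) μ) := by
    rw [← Finset.sum_add_distrib, ← Finset.sum_add_distrib]
    simp only [covDiv_flatCfg]
    refine Finset.sum_congr rfl fun μ _ => ?_
    rw [hpt x μ, hpt (x - e μ) μ, hGback μ]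
    abel
  have hsplit : covDiv flatCfg (fun y μ => mlog ((gaugeAct u V y μ : (Matrix n n ℂ)ˣ) : (Matrix n n ℂ))) x - covDiv flatCfg Z x - covLapSite flatCfg lam x
      = (∑ μ : Fin d, (Ad (u x) (Z x μ) - Ad (u (x - e μ)) (Z (x - e μ) μ)) - covDiv flatCfg Z x)
        + (∑ μ : Fin d, (mlog ((u x * (u (x + e μ))⁻¹ : (Matrix n n ℂ)ˣ) : (Matrix n n ℂ)) + mlog ((u x * (u (x - e μ))⁻¹ : (Matrix n n ℂ)ˣ) : (Matrix n n ℂ)))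
            - covLapSite flatCfg lam x)
        + ∑ μ : Fin d, (B x μ - B (x - e μ) μ) := by
    rw [hZ']; abel
  rw [hsplit]
  have hT1 := norm_sum_Ad_sub_covDiv_le huU hσ hγdn hZn x
  have hT2 := norm_sum_mlog_pureGauge_sub_covLapSite_le hΛ hΛ1 hγ hγ1 huU hu x
  have hT3 : ‖∑ μ : Fin d, (B x μ - B (x - e μ) μ)‖ ≤ d * (2 * (8 * r * (5 / 4 * γ))) := by
    calc _ ≤ ∑ _μ : Fin d, (8 * r * (5 / 4 * γ) + 8 * r * (5 / 4 * γ)) :=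
          (norm_sum_le _ _).trans (Finset.sum_le_sum fun μ _ => (norm_sub_le _ _).trans (add_le_add (hB _ _) (hB _ _)))
      _ = d * (2 * (8 * r * (5 / 4 * γ))) := by simp; ring
  calc _ ≤ ‖∑ μ : Fin d, (Ad (u x) (Z x μ) - Ad (u (x - e μ)) (Z (x - e μ) μ)) - covDiv flatCfg Z x‖
          + ‖∑ μ : Fin d, (mlog ((u x * (u (x + e μ))⁻¹ : (Matrix n n ℂ)ˣ) : (Matrix n n ℂ)) + mlog ((u x * (u (x - e μ))⁻¹ : (Matrix n n ℂ)ˣ) : (Matrix n n ℂ)))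
              - covLapSite flatCfg lam x‖
          + ‖∑ μ : Fin d, (B x μ - B (x - e μ) μ)‖ := norm_add₃_le
    _ ≤ (2 * (2 * Λ) * ‖covDiv flatCfg Z x‖ + 2 * d * (5 / 4 * γ) * (2 * r))
          + (4 * Λ * ‖covLapSite flatCfg lam x‖ + 14 * d * γ ^ 2) + d * (2 * (8 * r * (5 / 4 * γ))) :=
        add_le_add (add_le_add hT1 hT2) hT3
    _ = 4 * Λ * (‖covDiv flatCfg Z x‖ + ‖covLapSite flatCfg lam x‖) + 25 * d * r * γ + 14 * d * γ ^ 2 := by ring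

/-- **THE NEW RADIUS AND THE NEW POTENTIAL**: under the hypotheses of `norm_covDiv_mlog_gaugeAct_sub_le`,
`‖V^{u}(b) − 1‖ ≤ r + (5∕4)γ`, `‖log V^{u}(b)‖ ≤ 2(r + (5∕4)γ)`, and `log V^{u}(b)` is skew-adjoint. [folklore] -/
theorem gaugeAct_letters {V : Site d → Fin d → (Matrix n n ℂ)ˣ} (hV : IsUnitaryCfg V) {r : ℝ}
    (hr : ∀ (y : Site d) (μ : Fin d), ‖(V y μ : (Matrix n n ℂ)) - 1‖ ≤ r) (hr1 : r ≤ 1 / 20)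
    {lam : Site d → (Matrix n n ℂ)} (hlams : ∀ y, lam y ∈ skewAdjoint (Matrix n n ℂ)) {Λ γ : ℝ}
    (hΛ : ∀ y, ‖lam y‖ ≤ Λ) (hΛ1 : Λ ≤ 1 / 10) (hγ : ∀ (y : Site d) (μ : Fin d), ‖lam (y + e μ) - lam y‖ ≤ γ) (hγ1 : γ ≤ 1 / 25)
    {u : Site d → (Matrix n n ℂ)ˣ} (hu : ∀ y, (u y : (Matrix n n ℂ)) = exp (lam y)) (y : Site d) (μ : Fin d) :
    ‖((gaugeAct u V y μ : (Matrix n n ℂ)ˣ) : (Matrix n n ℂ)) - 1‖ ≤ r + 5 / 4 * γ ∧ ‖mlog ((gaugeAct u V y μ : (Matrix n n ℂ)ˣ) : (Matrix n n ℂ))‖ ≤ 2 * (r + 5 / 4 * γ) ∧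
      mlog ((gaugeAct u V y μ : (Matrix n n ℂ)ˣ) : (Matrix n n ℂ)) ∈ skewAdjoint (Matrix n n ℂ) ∧ gaugeAct u V y μ ∈ unitaryUnits (Matrix n n ℂ) := by
  have huU : IsUnitarySite u := expGauge_unitary hlams hu
  have hγu : ‖(u y : (Matrix n n ℂ)) - u (y + e μ)‖ ≤ 5 / 4 * γ :=
    (norm_expGauge_sub_expGauge_le hu hΛ hΛ1 _ _).trans (by rw [norm_sub_rev]; linarith [hγ y μ])
  have hunit : gaugeAct u V y μ ∈ unitaryUnits (Matrix n n ℂ) :=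
    (unitaryUnits (Matrix n n ℂ)).mul_mem ((unitaryUnits (Matrix n n ℂ)).mul_mem (huU y) (hV y μ)) ((unitaryUnits (Matrix n n ℂ)).inv_mem (huU _))
  have h1 : ‖((gaugeAct u V y μ : (Matrix n n ℂ)ˣ) : (Matrix n n ℂ)) - 1‖ ≤ r + 5 / 4 * γ :=
    (norm_gaugeBond_sub_one_le (hV y μ) (huU y) (huU (y + e μ))).trans (add_le_add (hr y μ) hγu)
  have h14 : ‖((gaugeAct u V y μ : (Matrix n n ℂ)ˣ) : (Matrix n n ℂ)) - 1‖ ≤ 1 / 4 := h1.trans (by linarith)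
  exact ⟨h1, (norm_mlog_le_two_mul (h14.trans (by norm_num))).trans (by linarith), mlog_mem_skewAdjoint_of_unitary hunit h14, hunit⟩

end Divergence

end

end Summit.QuantumFields.BalabanUV.T4Continuum.NE3.FlatLandauGaugeStep
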